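import Summits.QuantumFields.YangMills.Theorems.FluctuationComparisonRegPrIntLS2BetaOneStepLocalCrossingBounds
import Summits.QuantumFields.YangMills.Theorems.FluctuationComparisonRegPrIntLS2BetaDetRepLocalRows
import Literature.MathematicalPhysics.QuantumFieldTheory.Balaban1983to89.B10Eq71TorusLocal
import HarnessLib

/-!
# TUBE-REG∘ ∕ GAP♯∘ AT THE FLAT DATUM, DEPTH ONE, WITH A VOLUME-UNIFORM CONSTANT, I — the torus-side `ℓ²` bound: every bond of a comb-axial field with trivial
# one-step averages is controlled by the nearby plaquettes, and the sum over the torus costs a ball multiplicity, NOT the volume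
# (crux `FluctuationComparisonRegPrIntL`, stmt-QuantumFields-20520; registry v11.4 `Cruxes/FluctuationComparisonRegPrIntL/Lines/semiclassical_s2beta.lean` 3732b7df FROZEN, untouched)

Cell `ym3-torus` (YM ladder rung R3 = continuum `SU(2)` Yang–Mills on the three-torus — a RUNG: NOT d = 4, NOT infinite volume, NOT a mass gap, NOT Clay).
Width seat `ym3-torus-px12` (gen 22); `--kind proof --supports stmt-QuantumFields-20520 --as helper`, count-neutral, DEFINITION-FREE (0 `def`, 0 `instance`,
0 `notation`, 0 `sorry`, default heartbeats).

WHY.  The registered growth organs GAP♯∘ (`UniformFibreGapOrbit`) and the displayed TUBE-REG∘ choose `μ` BEFORE the run: `∃ μ > 0, ∀ F γ J K V …`.  At the flat datum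
the tree's letters ✓`…S2BetaFlatGapOutright.exists_tubeGrowth_flat ∕ exists_gapFlat_flat` (px12 g21 ∘ px16 g17 bricks 1–5) have `∃ μ` AFTER `∀ F γ J K` — the constant
comes from compactness of the configuration space of run `K` and depends on the lattice VOLUME.  This file proves the volume-uniform inequality at depth `K − J = 1`:
the kinematic sup machinery of [Balaban1985RegularSpaces] Lemma 1 in LOCAL form (✓`…S2BetaOneStepLocalAxialBounds` ∕ `…S2BetaOneStepLocalCrossingBounds`) bounds every
bond of the rooted comb-axial representative `W = v • U` of a flat-fibre field `U` by the plaquettes of `U` within torus distance `2dL + L` of the bond's block centre;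
squaring and summing costs a ball multiplicity (✓`…S2BetaDetRepLocalRows.card_filter_tdist_comp_le`) and `dist1² ≤ 4(1 − reTr)` on `SU(2)` (✓`B10Eq71TorusLocal`), never
the volume.

WHAT.
* §1 real ∕ counting lemmas: `le_mul_sqrt_of_forall`, `sum_dist1_sq_plaq_le_four_mul_wilsonAction4`, `card_filter_src_eq_le`.
* §2 ★ `dist1_sq_le_local_of_combAxial_one` (any torus `P`, `SU(N)`): for `W` in the complete `1`-block comb-axial gauge with trivial one-step (0.4) averages, EVERY bond
  satisfies `dist1(W ℓ)² ≤ C(d,L)²·Σ_{q : tdist q.src (emb (blockOf ℓ.src)) ≤ 2dL+L} dist1(W(∂q))²` as soon as that local sum is below the (0.4) guard.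
* §3 `card_bonds_near_le` (multiplicity of the block balls), ★★ `sum_dist1_sq_le_of_combAxial_one` — `Σ_ℓ dist1(W ℓ)² ≤ C(d,L)²·M(d,L)·Σ_q dist1(W(∂q))²`, constants in `d, L` only.
The companion `…S2BetaFlatTubeDepthOneUniform` carries the d = 3 carrier edition (`∃ μ(L)` before the run, GAP♯∘'s body at `(V, U₀) = (1, 1)`, depth one).

HONEST: depth ONE only (the depth-uniformity of TUBE-REG∘ — [Balaban1984PropagatorsII] (1.33), multi-scale — is NOT touched); the flat datum only (general window data
NOT touched); constants crude; lattice kinematics + Cauchy–Schwarz; nothing of Bałaban's analysis; TUBE-REG∘, GAP♯∘, EXW∘, S2β, crux 20520 NOT proved; no registered stub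
is closed; rung R3 = SU(2) YM₃ on T³ — NOT d = 4, NOT infinite volume, NOT a mass gap, NOT Clay; the Yang–Mills mass gap is NOT proved.  Sorry-free, axioms standard.

References: T. Bałaban, CMP **99** (1985) 75–102 [Balaban1985RegularSpaces] (Lemma 1 (1.24)–(1.26) pp.79–80); CMP **102** (1985) 277–309 [Balaban1985Variational]
((142) p.299, Thm 1 (8)–(10) p.279); CMP **96** (1984) 223–250 [Balaban1984PropagatorsII] ((1.33)); CMP **102** (1985) 255–275 [Balaban1985UV3] ((11) p.258, (12)–(13) p.259).
-/

set_option autoImplicit false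

noncomputable section

namespace Summit.QuantumFields.YangMills.Theorems.FluctuationComparisonRegPrIntLS2BetaFlatTubeDepthOneUniformTorus

open Finset
open Literature.MathematicalPhysics.QuantumFieldTheory.Balaban1983to89
open T4Continuum BlockAveraging AveragingRT ExpMeanLog
open B10Eq27TorusAxialLog (axialT)
open B5Eq118OneStroke (iterBlockOf)
open B15DeterminingSets (embIter)
open B3Taylor310LocalRemainder (tdist_comm tdist_self tdist_triangle)
open T3DescentFibreTower (avgFun_one expMeanLogSU_E_one)
open Summit.QuantumFields.YangMills.Theorems.FluctuationComparisonRegPrIntLS2BetaDetRepLocalRows (card_filter_tdist_comp_le)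
open Summit.QuantumFields.YangMills.Theorems.FluctuationComparisonRegPrIntLS2BetaOneStepLocalAxialBounds
open Summit.QuantumFields.YangMills.Theorems.FluctuationComparisonRegPrIntLS2BetaOneStepLocalCrossingBounds

/-! ## §1 Real and counting lemmas -/

section Lemmas

/-- If `D ≤ C·a` for every `a` strictly between `√S` and `t > √S` (`C ≥ 0`), then `D ≤ C·√S`. [folklore] -/
theorem le_mul_sqrt_of_forall {D C S t : ℝ} (hC : 0 ≤ C) (ht : Real.sqrt S < t)
    (h : ∀ a : ℝ, Real.sqrt S < a → a < t → D ≤ C * a) : D ≤ C * Real.sqrt S := by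
  refine le_of_forall_pos_lt_add fun δ hδ => ?_
  set a := min (Real.sqrt S + δ / (C + 1)) ((Real.sqrt S + t) / 2) with ha
  have hC1 : 0 < C + 1 := by linarith
  have h1 : Real.sqrt S < a := lt_min (by have := div_pos hδ hC1; linarith) (by linarith)
  have h2 : a < t := (min_le_right _ _).trans_lt (by linarith)
  have h3 : a ≤ Real.sqrt S + δ / (C + 1) := min_le_left _ _
  have h4 : C * (δ / (C + 1)) < δ := by
    rw [mul_div_assoc']
    rw [div_lt_iff₀ hC1]
    nlinarith
  calc D ≤ C * a := h a h1 h2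
    _ ≤ C * (Real.sqrt S + δ / (C + 1)) := mul_le_mul_of_nonneg_left h3 hC
    _ = C * Real.sqrt S + C * (δ / (C + 1)) := by ring
    _ < C * Real.sqrt S + δ := by linarith

variable {P : Params}

/-- `Σ_p dist1(U(∂p))² ≤ 4·wilsonAction4 U` on `SU(2)` (`dist1² ≤ 2N(1 − reTr)`, ✓`B10Eq71TorusLocal.dist1_sq_le_specialUnitaryGroup`). [cite: Balaban1985UV3, (11) p.258] -/
theorem sum_dist1_sq_plaq_le_four_mul_wilsonAction4 {j : ℕ} (U : GaugeField P j (Matrix.specialUnitaryGroup (Fin 2) ℂ)) :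
    ∑ q : Plaq P j, dist1 (GaugeField.plaqHol U q) ^ 2 ≤ 4 * wilsonAction4 U := by
  unfold wilsonAction4 wilsonAction
  rw [Finset.mul_sum]
  refine Finset.sum_le_sum fun q _ => ?_
  have h := B10Eq71TorusLocal.dist1_sq_le_specialUnitaryGroup (GaugeField.plaqHol U q)
  push_cast at h
  linarith

/-- At most `d` bonds start at a site. [folklore] -/
theorem card_filter_src_eq_le {j : ℕ} (y : Site P j) : (univ.filter fun ℓ : PBond P j => ℓ.src = y).card ≤ P.d := by
  classical
  calc (univ.filter fun ℓ : PBond P j => ℓ.src = y).card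
      ≤ (univ : Finset (Fin P.d)).card := by
        refine Finset.card_le_card_of_injOn (fun ℓ => ℓ.dir) (fun _ _ => Finset.mem_univ _) ?_
        rintro ⟨x, μ⟩ hx ⟨x', μ'⟩ hx' h
        simp only [Finset.coe_filter, Finset.mem_univ, true_and, Set.mem_setOf_eq] at hx hx' h
        subst hx; subst hx'; subst h; rfl
    _ = P.d := by simp

/-- At most `d²` plaquettes are based at a site. [folklore] -/
theorem card_filter_plaq_src_eq_le {j : ℕ} (y : Site P j) : (univ.filter fun q : Plaq P j => q.src = y).card ≤ P.d ^ 2 := by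
  classical
  calc (univ.filter fun q : Plaq P j => q.src = y).card
      ≤ (univ : Finset (Fin P.d × Fin P.d)).card := by
        refine Finset.card_le_card_of_injOn (fun q => (q.μ, q.ν)) (fun _ _ => Finset.mem_univ _) ?_
        rintro ⟨x, μ, ν, hμν⟩ hx ⟨x', μ', ν', hμν'⟩ hx' h
        simp only [Finset.coe_filter, Finset.mem_univ, true_and, Set.mem_setOf_eq, Prod.mk.injEq] at hx hx' h
        subst hx; subst hx'; obtain ⟨rfl, rfl⟩ := h; rfl
    _ = P.d ^ 2 := by simp [sq]

/-- A bond's plaquette-square sum over a ball is one term of it: `dist1(W(∂q))² ≤ Σ_{ball}` for `q` in the ball. [folklore] -/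
theorem sq_le_sum_ball {j : ℕ} {G : Type*} [GaugeGroup G] (W : GaugeField P j G) (c : Site P j) (R : ℕ) (q : Plaq P j)
    (hq : Site.tdist q.src c ≤ R) :
    dist1 (GaugeField.plaqHol W q) ^ 2 ≤ ∑ q' ∈ univ.filter (fun q' : Plaq P j => Site.tdist q'.src c ≤ R), dist1 (GaugeField.plaqHol W q') ^ 2 := by
  classical
  exact Finset.single_le_sum (f := fun q' => dist1 (GaugeField.plaqHol W q') ^ 2) (fun _ _ => sq_nonneg _)
    (Finset.mem_filter.mpr ⟨Finset.mem_univ _, hq⟩)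

end Lemmas

/-! ## §2 The per-bond local bound for a comb-axial field with trivial one-step averages (any torus, `SU(N)`) -/

section PerBond

open scoped Matrix.Norms.L2Operator

variable {P : Params} {n : Type*} [Fintype n] [DecidableEq n] [Nonempty n]

/-- ★ **EVERY BOND OF A COMB-AXIAL FIELD WITH TRIVIAL ONE-STEP AVERAGES IS CONTROLLED IN `ℓ²` BY THE NEARBY PLAQUETTES**: `W` in the complete `1`-block comb-axial gauge
(trivial comb transporters), `avgFun ℰ W = 1`, and the local square sum `S = Σ_{tdist q.src (emb (blockOf ℓ.src)) ≤ 2dL+L} dist1(W(∂q))²` with `√S` below the (0.4) guard ⟹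
`dist1(W ℓ)² ≤ (2(dL)² + 12·(((d+2)L)²∕4) + d·h·(4(dL)² + 2))²·S` (interior bonds by ✓`dist1_mul_inv_le_interior_local`, crossing bonds by ✓`dist1_cross_le_local`, both against
`Y := 1`, at every letter value `a ∈ (√S, guard)`; then `le_mul_sqrt_of_forall`). [cite: Balaban1985RegularSpaces, Lemma 1 (1.24)-(1.26) pp.79-80; Balaban1987RG1, (0.4) p.253] -/
theorem dist1_sq_le_local_of_combAxial_one (hk : 1 ≤ P.m + P.K) (W : GaugeField P 0 (Matrix.specialUnitaryGroup n ℂ))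
    (hax : ∀ x : Site P 0, axialT W (embIter 1 (iterBlockOf 1 x)) x =
      axialT (1 : GaugeField P 0 (Matrix.specialUnitaryGroup n ℂ)) (embIter 1 (iterBlockOf 1 x)) x)
    (havg : avgFun (expMeanLogSU (n := n)) W = 1) (ℓ : PBond P 0)
    (hS : Real.sqrt (∑ q ∈ univ.filter (fun q : Plaq P 0 => Site.tdist q.src (emb (iterBlockOf 1 ℓ.src)) ≤ 2 * P.d * P.L + P.L),
        dist1 (GaugeField.plaqHol W q) ^ 2) < deltaSU n / ((((P.d + 2) * P.L : ℕ) : ℝ) ^ 2 / 4)) :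
    dist1 (W ℓ) ^ 2 ≤
      (2 * ((P.d : ℝ) * (P.L : ℝ)) ^ 2 + 2 * (6 * ((((P.d + 2) * P.L : ℕ) : ℝ) ^ 2 / 4)) +
          ((P.d * ((P.L - 1) / 2) : ℕ) : ℝ) * (4 * ((P.d : ℝ) * (P.L : ℝ)) ^ 2 + 2)) ^ 2 *
        ∑ q ∈ univ.filter (fun q : Plaq P 0 => Site.tdist q.src (emb (iterBlockOf 1 ℓ.src)) ≤ 2 * P.d * P.L + P.L),
          dist1 (GaugeField.plaqHol W q) ^ 2 := by
  classical
  obtain ⟨x, μ⟩ := ℓ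
  set y : Site P 1 := iterBlockOf 1 x with hy
  set S := ∑ q ∈ univ.filter (fun q : Plaq P 0 => Site.tdist q.src (emb y) ≤ 2 * P.d * P.L + P.L), dist1 (GaugeField.plaqHol W q) ^ 2 with hSdef
  set C := 2 * ((P.d : ℝ) * (P.L : ℝ)) ^ 2 + 2 * (6 * ((((P.d + 2) * P.L : ℕ) : ℝ) ^ 2 / 4)) +
      ((P.d * ((P.L - 1) / 2) : ℕ) : ℝ) * (4 * ((P.d : ℝ) * (P.L : ℝ)) ^ 2 + 2) with hCdef
  have hC : 0 ≤ C := by positivity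
  have hS0 : 0 ≤ S := Finset.sum_nonneg fun _ _ => sq_nonneg _
  have hq4 : 0 < (((P.d + 2) * P.L : ℕ) : ℝ) ^ 2 / 4 := by
    have : 0 < (((P.d + 2) * P.L : ℕ) : ℝ) := by
      have h := P.L_pos
      exact_mod_cast Nat.mul_pos (by omega) h
    positivity
  -- the letter for `W` and for `Y := 1` at any level `a > √S`
  have hWa : ∀ a : ℝ, Real.sqrt S < a → ∀ q : Plaq P 0, Site.tdist q.src (emb y) ≤ 2 * P.d * P.L + P.L → dist1 (GaugeField.plaqHol W q) < a := by
    intro a ha q hq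
    have h1 : dist1 (GaugeField.plaqHol W q) ^ 2 ≤ S := sq_le_sum_ball W (emb y) _ q hq
    have h2 : dist1 (GaugeField.plaqHol W q) ≤ Real.sqrt S := (Real.le_sqrt (GaugeGroup.dist1_nonneg _) hS0).mpr h1
    exact h2.trans_lt ha
  have h1a : ∀ a : ℝ, Real.sqrt S < a → ∀ q : Plaq P 0, Site.tdist q.src (emb y) ≤ 2 * P.d * P.L + P.L →
      dist1 (GaugeField.plaqHol (1 : GaugeField P 0 (Matrix.specialUnitaryGroup n ℂ)) q) < a := by
    intro a ha q _
    have h0 : GaugeField.plaqHol (1 : GaugeField P 0 (Matrix.specialUnitaryGroup n ℂ)) q = 1 := by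
      show (1 : Matrix.specialUnitaryGroup n ℂ) * 1 * (1 : Matrix.specialUnitaryGroup n ℂ)⁻¹ * (1 : Matrix.specialUnitaryGroup n ℂ)⁻¹ = 1
      simp
    rw [h0, GaugeGroup.dist1_one]
    exact (Real.sqrt_nonneg S).trans_lt ha
  have hone : ((1 : GaugeField P 0 (Matrix.specialUnitaryGroup n ℂ)) ⟨x, μ⟩)⁻¹ = 1 := by
    show (1 : Matrix.specialUnitaryGroup n ℂ)⁻¹ = 1; exact inv_one
  -- the bound `dist1 (W ℓ) ≤ C·a` at every admissible letter value
  have hmain : ∀ a : ℝ, Real.sqrt S < a → a < deltaSU n / ((((P.d + 2) * P.L : ℕ) : ℝ) ^ 2 / 4) → dist1 (W ⟨x, μ⟩) ≤ C * a := by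
    intro a ha hat
    have ha0 : 0 ≤ a := (Real.sqrt_nonneg S).trans ha.le
    by_cases hcross : iterBlockOf 1 (x.shift μ) = iterBlockOf 1 x
    · -- interior bond
      have h := dist1_mul_inv_le_interior_local (k := 1) hk W 1 ha0 ha0 hax x μ hcross
        (ball_centre_of_ball W y μ x (Or.inl rfl) (hWa a ha)) (ball_centre_of_ball 1 y μ x (Or.inl rfl) (h1a a ha))
      rw [hone, mul_one, pow_one] at h
      have hrest : 0 ≤ (2 * (6 * ((((P.d + 2) * P.L : ℕ) : ℝ) ^ 2 / 4)) +
          ((P.d * ((P.L - 1) / 2) : ℕ) : ℝ) * (4 * ((P.d : ℝ) * (P.L : ℝ)) ^ 2 + 2)) * a := by positivity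
      calc dist1 (W ⟨x, μ⟩) ≤ ((P.d : ℝ) * (P.L : ℝ)) ^ 2 * (a + a) := h
        _ ≤ C * a := by rw [hCdef]; nlinarith
    · -- crossing bond
      have ht : ((((P.d + 2) * P.L : ℕ) : ℝ) ^ 2 / 4) * a < deltaSU n := by
        rwa [lt_div_iff₀ hq4, mul_comm] at hat
      have havg' : dist1 (avgFun (expMeanLogSU (n := n)) W ⟨iterBlockOf 1 x, μ⟩ *
          (avgFun (expMeanLogSU (n := n)) (1 : GaugeField P 0 (Matrix.specialUnitaryGroup n ℂ)) ⟨iterBlockOf 1 x, μ⟩)⁻¹) ≤ 0 := by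
        rw [havg, avgFun_one _ expMeanLogSU_E_one]
        show dist1 ((1 : Matrix.specialUnitaryGroup n ℂ) * (1 : Matrix.specialUnitaryGroup n ℂ)⁻¹) ≤ 0
        rw [inv_one, mul_one, GaugeGroup.dist1_one]
      have h := dist1_cross_le_local hk ha0 W 1 hax x μ hcross (hWa a ha) (h1a a ha) ht havg'
      rw [hone, mul_one, zero_add] at h
      have hrest : 0 ≤ 2 * ((P.d : ℝ) * (P.L : ℝ)) ^ 2 * a := by positivity
      calc dist1 (W ⟨x, μ⟩) ≤ 2 * (6 * (((((P.d + 2) * P.L : ℕ) : ℝ) ^ 2 / 4) * a)) +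
            ((P.d * ((P.L - 1) / 2) : ℕ) : ℝ) * ((4 * ((P.d : ℝ) * (P.L : ℝ)) ^ 2 + 2) * a) := h
        _ ≤ C * a := by rw [hCdef]; nlinarith
  have hle : dist1 (W ⟨x, μ⟩) ≤ C * Real.sqrt S := le_mul_sqrt_of_forall hC hS hmain
  have hd0 : 0 ≤ dist1 (W ⟨x, μ⟩) := GaugeGroup.dist1_nonneg _
  calc dist1 (W ⟨x, μ⟩) ^ 2 ≤ (C * Real.sqrt S) ^ 2 := pow_le_pow_left₀ hd0 hle 2
    _ = C ^ 2 * S := by rw [mul_pow, Real.sq_sqrt hS0]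

end PerBond

/-! ## §3 The volume-uniform `ℓ²` bound over the whole torus (any torus, `SU(N)`) -/

section Torus

open scoped Matrix.Norms.L2Operator

variable {P : Params} {n : Type*} [Fintype n] [DecidableEq n] [Nonempty n]

/-- **MULTIPLICITY OF THE BLOCK BALLS**: a plaquette lies in the `(2dL + L)`-ball about the block centre of at most `d·(2(2dL + L + dL) + 1)^d` bonds' sources (volume-free).
(bookkeeping; ✓`card_filter_tdist_comp_le` along `ℓ ↦ ℓ.src`) [cite: Balaban1985UV3, p.258] -/
theorem card_bonds_near_le (hk : 1 ≤ P.m + P.K) (q : Plaq P 0) :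
    (univ.filter fun ℓ : PBond P 0 => Site.tdist q.src (emb (iterBlockOf 1 ℓ.src)) ≤ 2 * P.d * P.L + P.L).card ≤
      P.d * (2 * (2 * P.d * P.L + P.L + P.d * P.L) + 1) ^ P.d := by
  classical
  refine le_trans (Finset.card_le_card fun ℓ hℓ => ?_)
    (card_filter_tdist_comp_le (fun ℓ : PBond P 0 => ℓ.src) (m := P.d) card_filter_src_eq_le q.src (2 * P.d * P.L + P.L + P.d * P.L))
  rw [Finset.mem_filter] at hℓ ⊢
  refine ⟨Finset.mem_univ _, ?_⟩
  have h1 : Site.tdist (emb (iterBlockOf 1 ℓ.src)) ℓ.src ≤ P.d * P.L := by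
    have h := tdist_centre_le (k := 1) hk ℓ.src
    rw [pow_one, tdist_comm] at h
    exact h
  exact (tdist_triangle _ _ _).trans (add_le_add hℓ.2 h1)

/-- ★★ **THE VOLUME-UNIFORM `ℓ²` BOUND**: for `W` in the complete `1`-block comb-axial gauge with trivial one-step (0.4) averages and every block ball below the guard,
`Σ_ℓ dist1(W ℓ)² ≤ C(d,L)²·d(2(3dL+L)+1)^d·Σ_q dist1(W(∂q))²` — the constant depends on `d, L` only, NOT on the torus.
[cite: Balaban1985RegularSpaces, Lemma 1 (1.24)-(1.26) pp.79-80; Balaban1984PropagatorsII, (1.33)] -/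
theorem sum_dist1_sq_le_of_combAxial_one (hk : 1 ≤ P.m + P.K) (W : GaugeField P 0 (Matrix.specialUnitaryGroup n ℂ))
    (hax : ∀ x : Site P 0, axialT W (embIter 1 (iterBlockOf 1 x)) x =
      axialT (1 : GaugeField P 0 (Matrix.specialUnitaryGroup n ℂ)) (embIter 1 (iterBlockOf 1 x)) x)
    (havg : avgFun (expMeanLogSU (n := n)) W = 1)
    (hS : ∀ y : Site P 1, Real.sqrt (∑ q ∈ univ.filter (fun q : Plaq P 0 => Site.tdist q.src (emb y) ≤ 2 * P.d * P.L + P.L),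
        dist1 (GaugeField.plaqHol W q) ^ 2) < deltaSU n / ((((P.d + 2) * P.L : ℕ) : ℝ) ^ 2 / 4)) :
    ∑ ℓ : PBond P 0, dist1 (W ℓ) ^ 2 ≤
      (2 * ((P.d : ℝ) * (P.L : ℝ)) ^ 2 + 2 * (6 * ((((P.d + 2) * P.L : ℕ) : ℝ) ^ 2 / 4)) +
          ((P.d * ((P.L - 1) / 2) : ℕ) : ℝ) * (4 * ((P.d : ℝ) * (P.L : ℝ)) ^ 2 + 2)) ^ 2 *
        (((P.d * (2 * (2 * P.d * P.L + P.L + P.d * P.L) + 1) ^ P.d : ℕ) : ℝ) * ∑ q : Plaq P 0, dist1 (GaugeField.plaqHol W q) ^ 2) := by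
  classical
  set C := 2 * ((P.d : ℝ) * (P.L : ℝ)) ^ 2 + 2 * (6 * ((((P.d + 2) * P.L : ℕ) : ℝ) ^ 2 / 4)) +
      ((P.d * ((P.L - 1) / 2) : ℕ) : ℝ) * (4 * ((P.d : ℝ) * (P.L : ℝ)) ^ 2 + 2) with hCdef
  set M : ℕ := P.d * (2 * (2 * P.d * P.L + P.L + P.d * P.L) + 1) ^ P.d with hMdef
  set f : Plaq P 0 → ℝ := fun q => dist1 (GaugeField.plaqHol W q) ^ 2 with hfdef
  have hf0 : ∀ q, 0 ≤ f q := fun q => sq_nonneg _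
  -- per bond
  have hbond : ∀ ℓ : PBond P 0, dist1 (W ℓ) ^ 2 ≤
      C ^ 2 * ∑ q ∈ univ.filter (fun q : Plaq P 0 => Site.tdist q.src (emb (iterBlockOf 1 ℓ.src)) ≤ 2 * P.d * P.L + P.L), f q :=
    fun ℓ => dist1_sq_le_local_of_combAxial_one hk W hax havg ℓ (hS _)
  -- exchange of summations and the multiplicity
  have hex : ∑ ℓ : PBond P 0, ∑ q ∈ univ.filter (fun q : Plaq P 0 => Site.tdist q.src (emb (iterBlockOf 1 ℓ.src)) ≤ 2 * P.d * P.L + P.L), f q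
      ≤ (M : ℝ) * ∑ q : Plaq P 0, f q := by
    calc ∑ ℓ : PBond P 0, ∑ q ∈ univ.filter (fun q : Plaq P 0 => Site.tdist q.src (emb (iterBlockOf 1 ℓ.src)) ≤ 2 * P.d * P.L + P.L), f q
        = ∑ ℓ : PBond P 0, ∑ q : Plaq P 0,
            (if Site.tdist q.src (emb (iterBlockOf 1 ℓ.src)) ≤ 2 * P.d * P.L + P.L then f q else 0) := by
          refine Finset.sum_congr rfl fun ℓ _ => ?_
          rw [Finset.sum_filter]
      _ = ∑ q : Plaq P 0, ∑ ℓ : PBond P 0,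
            (if Site.tdist q.src (emb (iterBlockOf 1 ℓ.src)) ≤ 2 * P.d * P.L + P.L then f q else 0) := Finset.sum_comm
      _ = ∑ q : Plaq P 0,
            ((univ.filter fun ℓ : PBond P 0 => Site.tdist q.src (emb (iterBlockOf 1 ℓ.src)) ≤ 2 * P.d * P.L + P.L).card : ℝ) * f q := by
          refine Finset.sum_congr rfl fun q _ => ?_
          rw [← Finset.sum_filter, Finset.sum_const, nsmul_eq_mul]
      _ ≤ ∑ q : Plaq P 0, (M : ℝ) * f q := by
          refine Finset.sum_le_sum fun q _ => mul_le_mul_of_nonneg_right ?_ (hf0 q)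
          exact_mod_cast card_bonds_near_le hk q
      _ = (M : ℝ) * ∑ q : Plaq P 0, f q := by rw [Finset.mul_sum]
  calc ∑ ℓ : PBond P 0, dist1 (W ℓ) ^ 2
      ≤ ∑ ℓ : PBond P 0, C ^ 2 * ∑ q ∈ univ.filter (fun q : Plaq P 0 => Site.tdist q.src (emb (iterBlockOf 1 ℓ.src)) ≤ 2 * P.d * P.L + P.L), f q :=
        Finset.sum_le_sum fun ℓ _ => hbond ℓ
    _ = C ^ 2 * ∑ ℓ : PBond P 0, ∑ q ∈ univ.filter (fun q : Plaq P 0 => Site.tdist q.src (emb (iterBlockOf 1 ℓ.src)) ≤ 2 * P.d * P.L + P.L), f q := by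
        rw [Finset.mul_sum]
    _ ≤ C ^ 2 * ((M : ℝ) * ∑ q : Plaq P 0, f q) := mul_le_mul_of_nonneg_left hex (sq_nonneg _)
    _ = _ := by rw [hMdef]

end Torus

end Summit.QuantumFields.YangMills.Theorems.FluctuationComparisonRegPrIntLS2BetaFlatTubeDepthOneUniformTorus

end
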